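import Summits.QuantumFields.BalabanUV.T4Continuum.Spine.NE7.QLaConeNeighbourhood
import Summits.QuantumFields.BalabanUV.T4Continuum.Spine.NE7.QLaBlockAvgTwoLevelContraction

/-!
# Spine/NE7/QLaConeNeighbourhoodPrinted — NODE S's cone-local defect bound FOR EVERY DATUM OF THE HEADLINE'S CLASS: the canonical
# cone of file 41 composed with the class certificate of files 29∕33, all binders but the walk ∕ support data discharged

Cell `pub-balaban-gaps` (YM blitz Y1, track G2, seat `ne7`, generation 11); text of record
`run/shared/lean/pub/pub-balaban-gaps/ne/NE7.md` (v11: census R68).  43rd `Spine/NE7/` file; 0 `def`, 0 sorry.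

WHY.  File 41 (`QLaConeNeighbourhood`) states NODE S's defect bound with its canonical cone for an ARBITRARY averaging satisfying
`LoopDefectBound av dom Cd θ`, with the binders `1 ∈ dom` and the truncation hypothesis `htrunc` left to the consumer.  For the class the
headline `T4ContinuumYM4Torus.continuumYM4_torus_of_BetaPertH` quantifies over — finite-`ε` data `D : FiniteEpsData F SU(N)` with
`D.IsPrintedAveraged` ([Balaban1987RG1] (0.4) OR (0.10)–(0.12), `T4ApexPrinted`) — file 33 PROVED `LoopDefectBound (D.av K) (domPrinted …)
(½e²) (θ)` with `θ = L^{1−d}` (`loopDefectBound_of_isPrintedAveraged`), on the sup-ball domains `domPrinted = dom ∩ dom₂` where the truncation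
of a configuration is automatic and `1 ∈ domPrinted` (`one_mem_domPrinted`).  This file is the composition: **`loopDefect_le_of_near_support_printed`**
— for EVERY such datum, every cutoff `K`, every closed walk of `T^{(k+n)}` and every configuration `V ∈ domPrinted` at level `k` trivial off
`Λ` with one-bond deviations `≤ Dm`: `1 − W(avg_K^{k→k+n} V)(walk x w) ≤ ½e²·(|w|·|Λ_near|·Dm)²·(L^{2(1−d)})ⁿ`, `Λ_near` = the bonds of `Λ`
whose source centre is within `(d+2)(L^{k+n} − L^k)` finest units of a loop site's centre.  The ONLY inputs left are the walk and the
support data — i.e. NODE O's objects (which `V`, which `Λ`) and rows NE7b∕NE7c's booking (how many components near the loop).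

HONEST FRAMING.  A composition of tree theorems by name; [folklore]; no object of Bałaban's is constructed.  NE7 NOT proved; spine 0∕9;
one fixed finite T⁴ — NOT ℝ⁴, NOT infinite volume, NOT a mass gap, NOT Clay.  No classification word moves (R10).
-/

noncomputable section

open Finset
open scoped BigOperators

namespace Summit.QuantumFields.BalabanUV.T4Continuum.Spine.NE7

open Literature.MathematicalPhysics.QuantumFieldTheory.Balaban1983to89
open Literature.MathematicalPhysics.QuantumFieldTheory.Balaban1983to89.T4Continuum
open Literature.MathematicalPhysics.QuantumFieldTheory.Balaban1983to89.T4AvgSensitivity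
open Literature.MathematicalPhysics.QuantumFieldTheory.Balaban1983to89.T4AvgDerivBound
open Literature.MathematicalPhysics.QuantumFieldTheory.Balaban1983to89.B15DeterminingSets (embIter)
open Literature.MathematicalPhysics.QuantumFieldTheory.Balaban1983to89.T4Continuum.FiniteEpsData

variable {F : T4Family} {N : ℕ} [NeZero N]

open Classical in
/-- A configuration of the printed common domain `domPrinted = dom ∩ dom₂` (sup-balls), truncated to any bond set (`V` on `S`, `1` off
`S`), stays in the domain. [folklore] -/
theorem truncate_mem_domPrinted {P : Params} {j : ℕ} {V : GaugeField P j (Matrix.specialUnitaryGroup (Fin N) ℂ)}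
    (hV : V ∈ domPrinted P (Fin N) j) (S : Finset (PBond P j)) :
    (fun b => if b ∈ S then V b else 1) ∈ domPrinted P (Fin N) j := by
  refine ⟨fun b => ?_, fun b => ?_⟩
  · show dist1 (if b ∈ S then V b else 1) ≤ rad P (Fin N) j
    by_cases hb : b ∈ S
    · rw [if_pos hb]; exact hV.1 b
    · rw [if_neg hb]; exact one_mem_dom (n := Fin N) j b
  · show dist1 (if b ∈ S then V b else 1) ≤ rad₂ P (Fin N) j
    by_cases hb : b ∈ S
    · rw [if_pos hb]; exact hV.2 b
    · rw [if_neg hb]; exact one_mem_dom₂ (n := Fin N) j b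

open Classical in
/-- **NODE S's CONE-LOCAL DEFECT BOUND FOR THE HEADLINE'S CLASS.**  For every finite-`ε` datum `D` over `SU(N)` with
`D.IsPrintedAveraged` (the exact hypothesis `hD` of `continuumYM4_torus_of_BetaPertH`), every cutoff `K`, levels `k + n ≤ m + K`, every
closed walk `(x, w)` of `T^{(k+n)}`, and every level-`k` configuration `V ∈ domPrinted` trivial off a finite bond set `Λ` with one-bond
deviations `≤ Dm` on `Λ`: `1 − W(iterFrom (D.av K) k n V)(walk x w) ≤ ½e²·(|w|·|Λ_near|·Dm)²·(θ²)ⁿ`, `θ = L^{1−d}` (`theta`), where `Λ_near`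
(`hΛD`) = the bonds of `Λ` whose source centre lies within `ℓ¹`-distance `(d+2)(L^{k+n} − L^k)` (finest lattice) of the centre of the source
of a step of the loop.  Files 33 (`loopDefectBound_of_isPrintedAveraged`) + 41 (`loopDefect_le_of_near_support`); truncation and `1 ∈ dom`
discharged here. [folklore] -/
theorem loopDefect_le_of_near_support_printed (D : FiniteEpsData F (Matrix.specialUnitaryGroup (Fin N) ℂ))
    (hD : D.IsPrintedAveraged) (K : ℕ) {k n : ℕ} (hn : k + n ≤ (F.P K).m + (F.P K).K)
    (x : Site (F.P K) (k + n)) (w : List (Letter (F.P K).d)) (hw : walkEnd x w = x)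
    (V : GaugeField (F.P K) k (Matrix.specialUnitaryGroup (Fin N) ℂ)) (hV : V ∈ domPrinted (F.P K) (Fin N) k)
    (Λ ΛD : Finset (PBond (F.P K) k))
    (hΛD : ∀ b, b ∈ ΛD ↔ b ∈ Λ ∧ ∃ s ∈ walk x w,
      Site.tdist (embIter k b.src) (embIter (k + n) s.bond.src)
        ≤ ((F.P K).d + 2) * ((F.P K).L ^ (k + n) - (F.P K).L ^ k))
    (hoff : ∀ b, b ∉ Λ → V b = 1) {Dm : ℝ} (hDm : ∀ b ∈ Λ, dist1 (V b) ≤ Dm) :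
    1 - loopAt (iterFrom (D.av K) k n V) (walk x w)
      ≤ 1 / 2 * Real.exp 1 ^ 2 * ((w.length : ℝ) * ΛD.card * Dm) ^ 2 * (theta (F.P K) ^ 2) ^ n :=
  loopDefect_le_of_near_support (loopDefectBound_of_isPrintedAveraged D hD K) (by positivity) (theta_pos (F.P K)).le hn
    x w hw V (one_mem_domPrinted (n := Fin N) k) Λ ΛD hΛD hoff hDm (truncate_mem_domPrinted hV ΛD)

open Classical in
/-- The same with `Λ_near` THE filtered set (no characterisation hypothesis): the charged bonds are
`Λ.filter (fun b => ∃ s ∈ walk x w, tdist (embIter k b.src) (embIter (k+n) s.bond.src) ≤ (d+2)(L^{k+n} − L^k))`. [folklore] -/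
theorem loopDefect_le_of_near_support_printed' (D : FiniteEpsData F (Matrix.specialUnitaryGroup (Fin N) ℂ))
    (hD : D.IsPrintedAveraged) (K : ℕ) {k n : ℕ} (hn : k + n ≤ (F.P K).m + (F.P K).K)
    (x : Site (F.P K) (k + n)) (w : List (Letter (F.P K).d)) (hw : walkEnd x w = x)
    (V : GaugeField (F.P K) k (Matrix.specialUnitaryGroup (Fin N) ℂ)) (hV : V ∈ domPrinted (F.P K) (Fin N) k)
    (Λ : Finset (PBond (F.P K) k)) (hoff : ∀ b, b ∉ Λ → V b = 1) {Dm : ℝ} (hDm : ∀ b ∈ Λ, dist1 (V b) ≤ Dm) :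
    1 - loopAt (iterFrom (D.av K) k n V) (walk x w)
      ≤ 1 / 2 * Real.exp 1 ^ 2 * ((w.length : ℝ)
          * (Λ.filter fun b => ∃ s ∈ walk x w, Site.tdist (embIter k b.src) (embIter (k + n) s.bond.src)
              ≤ ((F.P K).d + 2) * ((F.P K).L ^ (k + n) - (F.P K).L ^ k)).card * Dm) ^ 2
        * (theta (F.P K) ^ 2) ^ n :=
  loopDefect_le_of_near_support_printed D hD K hn x w hw V hV Λ _ (fun _ => Finset.mem_filter) hoff hDm

end Summit.QuantumFields.BalabanUV.T4Continuum.Spine.NE7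

end
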